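import Mathlib
import HarnessLib
import HarnessLib.Audit
import Summits.KontsevichZagierPeriods.Statement
import Summits.KontsevichZagierPeriods.KontsevichZagierPeriods.Theorems.HyperbolicBlochCyclicCalibration
import Summits.KontsevichZagierPeriods.KontsevichZagierPeriods.Theorems.ExpConservativeKernelImpliesStatement
import HarnessLib.Audit.Status.Attr

/-!
Route: HyperbolicBloch

# Route HyperbolicBloch — the five-term relation is two domain-additivity moves in ℍ³ — weight-2
scissors transfer, sector conditional on Zagier's dilogarithm conjecture

Card hyperbolic-bloch-sector. For algebraic z with Im z > 0 the ideal tetrahedron T(z) ⊂ ℍ³ with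
vertices ∞, 0, 1, z is a
ℚ-semialgebraic solid and the hyperbolic volume form is the RATIONAL density t⁻³, so ρ(z) = [T(z),
t⁻³] is a KZ-rational
representation of dimension 3 (value D(z), Bloch–Wigner; Milnor1982). Both generators of ideal
scissors congruence are literal
moves of the fixed calculus: isometries of ℍ³ with algebraic Möbius coefficients are rule (2) (|det
Dg| = (g₃/t)³, IsometryMove) and
the 2–3 Pachner move is two instances of rule (1a) (PachnerTwoThree). X = X₁ ∧ X₂: X₁ (TRANSFER,
unconditional theorem-candidate)
= every instance over ℚ̄ of the five-term relation is a KZ relation among the ρ(z)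
(FiveTermTransfer); X₂ (SECTOR, target
TetraSector) = Zagier's conjecture in volume/ℤ-form (every ℤ-linear relation among vol T(zᵢ), zᵢ ∈
ℚ̄, lies in the span of five-term,
[w]+[w̄] and [real] relators; Neumann1998 §2.1) ⇒ the kernel form of Conjecture 1 on the subgroup of
FormalRep generated by the ρ(z):
Σ nᵢ vol ρ(zᵢ) = 0 ⇒ Σ nᵢ[ρ(zᵢ)] ∈ KZ.relations. This is the weight-2 rung (above LowDimension =
weight 1, Baker) of the scissors part
of the kernel form of Conjecture 1. Deciding theorem (rev 2–3, D-0027 §2.1): `closes : TetraSector →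
ZagierDilogarithmConjecture → OffTetraSectorKernel →
KontsevichZagierPeriods` — the sector, its NAMED transcendence input (support item = TetraSector's
inline hypothesis), and the
NOT-CLAIMED remainder of the summit (kernel form with the tetrahedral value-relators adjoined).
Lean: `∀ (T : ℂ → Set (Fin 3 → ℝ)), (∀ z, T z = {p | 0 < p 1 ∧ z.re * p 1 < z.im * p 0 ∧ z.im * (p 0
- 1) < (z.re - 1) * p 1 ∧ 0 < p 2 ∧ 0 < z.im * (p 0 ^ 2 + p 1 ^ 2 + p 2 ^ 2 - p 0) + (z.re -
Complex.normSq z) * p 1}) → (∀ (k : ℕ) (z : Fin k → ℂ) (n : Fin k → ℤ), (∀ i, IsAlgebraic ℚ (z i)) →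
(∀ i, 0 < (z i).im) → ∑ i, (n i : ℝ) * (∫ p in T (z i), 1 / p 2 ^ 3) = 0 → (∑ i, n i •
FreeAbelianGroup.of (z i)) ∈ AddSubgroup.closure ({c : FreeAbelianGroup ℂ | ∃ x y : ℂ, IsAlgebraic ℚ
x ∧ IsAlgebraic ℚ y ∧ x ≠ 0 ∧ x ≠ 1 ∧ y ≠ 0 ∧ y ≠ 1 ∧ x ≠ y ∧ c = FreeAbelianGroup.of x -
FreeAbelianGroup.of y + FreeAbelianGroup.of (y / x) - FreeAbelianGroup.of ((1 - x⁻¹) / (1 - y⁻¹)) +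
FreeAbelianGroup.of ((1 - x) / (1 - y))} ∪ {c | ∃ w : ℂ, IsAlgebraic ℚ w ∧ c = FreeAbelianGroup.of w
+ FreeAbelianGroup.of ((starRingEnd ℂ) w)} ∪ {c | ∃ w : ℂ, w.im = 0 ∧ c = FreeAbelianGroup.of w})) →
∀ (ρ : ℂ → Literature.NumberTheory.Transcendental.KZ.IntegralRep 3), (∀ z, IsAlgebraic ℚ z → 0 <
z.im → (ρ z).domain = T z ∧ Set.EqOn (ρ z).integrand (fun p => 1 / p 2 ^ 3) (T z)) → ∀ (k : ℕ) (z :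
Fin k → ℂ) (n : Fin k → ℤ), (∀ i, IsAlgebraic ℚ (z i)) → (∀ i, 0 < (z i).im) → ∑ i, (n i : ℝ) * (ρ
(z i)).value = 0 → (∑ i, n i • Literature.NumberTheory.Transcendental.KZ.of (ρ (z i))) ∈
Literature.NumberTheory.Transcendental.KZ.relations`

## Assembly
The route is a SECTOR of the kernel form: TetraSector is the kernel form of Conjecture 1 restricted
to the subgroup of FormalRep generated by the
ℚ̄-ideal-tetrahedron representations, conditional on Zagier's conjecture, and made
unconditional-minus-Zagier by FiveTermTransfer (via
SectorReduction). Glue-first repair (rev 2–3): the transcendence input is the named support item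
ZagierDilogarithmConjecture (verbatim the
inline hypothesis; open conjecture, not staffed) and the complement of the sector is the support
item OffTetraSectorKernel (∀ c, eval c = 0 →
c ∈ KZ.relations ⊔ closure{tetrahedral value-relators}; NOT CLAIMED by this route, idiom of
OctahedralSymmetry.LevelFourSectorKernel); the item
Assembly = TetraSector → ZagierDilogarithmConjecture → OffTetraSectorKernel →
KontsevichZagierPeriods is PROVED as `closes` (KZ.eval_of on
[r] − [r'], sup_le + AddSubgroup.closure_le, each adjoined relator discharged by TetraSector). The
shared kernel step stmt-KontsevichZagierPeriods-0197
(full kernel form → summit) is no longer an item of this route, so no decl here names an open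
Literature conjecture. The sector is one rung
(weight 2) of the scissors ladder (weight 1 = route LowDimension/Baker; weight n = Goncharov's
hyperbolic (2n−1)-simplices).

Rationale: WHY THIS LINE. Hyperbolic geometry realises the weight-2 motivic (pre-Bloch) relations as
cut-and-paste of ℚ-semialgebraic solids with a rational
density: Dupont–Sah identify the ideal scissors congruence group P(ℍ³) with P(ℂ)⁻ and the five-term
relation with the 2–3 move
(DupontSah1982 §§3–5), Goncharov1999 reads volumes of ℚ̄-simplices as periods of mixed Tate motives,
and Neumann1998 records Zagier's
conjecture (volume injective on P(ℚ̄)⁻; Milnor's Lobachevsky conjecture is its cyclotomic case) and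
the unique divisibility of
P(ℚ̄) (Dupont–Sah + Suslin) that makes the ℤ-form of the hypothesis equivalent to the printed
ℚ-form. Imported areas: hyperbolic
3-geometry / scissors congruence (the moves), algebraic K-theory of fields (Bloch group bookkeeping,
divisibility), transcendence
(Zagier's conjecture as the ONLY non-geometric input). No prior route or negative touches
dimension-3 rational representations; the
line needs no Newton–Leibniz move at all, so the primitive obstruction is structurally absent, and
it keeps dissection, so the
Hauptvermutung obstruction is absent too.

RANKED CRUXES. #0 TetraSector (target) — Zagier's conjecture in volume/ℤ-form (hypothesis, inline:
zᵢ ∈ ℚ̄ ∩ ℍ⁺, nᵢ ∈ ℤ, Σ nᵢ ∫_{T(zᵢ)} t⁻³ = 0 ⇒ Σ nᵢ[zᵢ] ∈ ℤ-span{five-term instances over ℚ̄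
(Neumann's form D(x)−D(y)+D(y/x)−D((1−x⁻¹)/(1−y⁻¹))+D((1−x)/(1−y))), [w]+[w̄], [real w]} in
FreeAbelianGroup ℂ) ⇒ for every choice ρ of KZ reps on the standard tetrahedra T(z) (z algebraic, Im
z > 0) with integrand t⁻³: Σ nᵢ·value(ρ zᵢ) = 0 ⇒ Σ nᵢ•[ρ zᵢ] ∈ KZ.relations (kernel form of
Conjecture 1 on the tetrahedral subgroup). (why it might fail: the hypothesis (Zagier's conjecture ⊋
Goncharov Conj 2.8 ⊋ Milnor) could be false: a ℚ-relation among D at algebraic points outside the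
five-term span would make the target vacuous and, via GPC(MT, w ≤ 2), contradict the summit's
motivic reading; none is known.) [Neumann1998, Goncharov1999, Zagier2007Dilogarithm, Milnor1982,
DupontSah1982]
#2 FiveTermTransfer (crux) — for algebraic x ≠ y in ℂ∖{0,1}: B(x) − B(y) + B(y/x) −
B((1−x⁻¹)/(1−y⁻¹)) + B((1−x)/(1−y)) ∈ KZ.relations, where B(w) = [ρ w] (Im w > 0), −[ρ w̄] (Im w <
0), 0 (w real), ρ w any rep on T(w) with integrand t⁻³ (card: 'THEOREM-CANDIDATE Transfer, weight
2'). Proof plan: the five terms are the five sub-tetrahedra of {∞,0,1,x,y} ⊂ ∂ℍ³ (Dupont–Sah (5.3));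
generic case = bipyramid: move an apex to ∞ by IsometryMove and apply PachnerTwoThree; 4-concyclic
case = one real term + PachnerTwoTwo after moving the fifth point to ∞; 5-concyclic = all terms
zero; each piece is normalised to a standard T(·) or its mirror by IsometryMove (ε = −1 gives
[mirror of T(w̄)] = B-convention). [deps: PachnerTwoThree, IsometryMove] [difficulty: L] (why it
might fail: only through the case analysis: a sign/orientation mismatch between the B(w̄) convention
and the geometric 2-side/3-side in some degenerate (4-concyclic, coincident-term) configuration, or
a non-null overlap; Dupont–Sah's P(∂ℍ³) ≅ P_ℂ⁻ (1982 §4, Rem. after 4.7) says every instance is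
geometric.) [DupontSah1982, Neumann1998, Zagier2007Dilogarithm, KontsevichZagier2001]
#3 PachnerTwoThree (crux) — 2–3 move with apexes ∞ and an inner point: for algebraic u, v, w, q with
q strictly inside the counter-clockwise triangle (u,v,w): [prism(u,v,w)] + [inner tetrahedron
(q;u,v,w)] − [prism(u,v,q)] − [prism(v,w,q)] − [prism(w,u,q)] ∈ KZ.relations, all with integrand
t⁻³; prism(u,v,w) = {t > 0, left of u→v, v→w, w→u, outside the circumsphere S(u,v,w) > 0}, inner =
{t > 0, S(u,v,w) < 0, S(u,v,q) > 0, S(v,w,q) > 0, S(w,u,q) > 0} (S = 4×4 circumsphere determinant,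
positive outside for ccw triples). Two domainAddRel moves: both sides are a.e. the prism over
(u,v,w) above the three small hemispheres (Monte-Carlo: 0 mismatches / 4·10⁵). [difficulty: M] (why
it might fail: the half-space description of the inner tetrahedron (below H(u,v,w), above the three
H(·,·,q)) needs the small circumcircles empty — automatic only since q is interior (Delaunay); a
wrong side/orientation makes the a.e. identity false; overlaps must be null sphere pieces.)
[DupontSah1982, BenedettiPetronio1992, Thurston1997, KontsevichZagier2001]
#4 IsometryMove (crux) — for algebraic a, b, c, d ∈ ℂ with ad − bc ≠ 0 and ε = ±1, the Poincaré
extension g(w,t) = (((aw+b)·conj(cw+d) + a·conj(c)·t²)/N, |ad−bc|·t/N), N = |cw+d|² + |c|²t²,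
precomposed with (x,y) ↦ (x,εy), maps any rep r on a domain σ ⊆ {t > 0} with integrand t⁻³ to an
equivalent rep on g(σ) with integrand t⁻³: ONE changeOfVariablesRel move, since g is
ℚ-semialgebraic, injective, smooth and |det Dg| = (g₃/t)³ (conformal isometry; checked numerically),
so t⁻³ = (g₃)⁻³·|det Dg|. [difficulty: M] (why it might fail: only if the explicit upper-half-space
formula or the ε-reflection convention were wrong, or if ℚ-semialgebraicity of g needed more than
algebraic a,b,c,d (it does not: re/im algebraic + Tarski–Seidenberg, proved in tree); transcendental
coefficients are NOT moves.) [BenedettiPetronio1992, Thurston1997, KontsevichZagier2001,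
BochnakCosteRoy1998]
#9 SectorReduction (support) — FiveTermTransfer → TetraSector: lift w ↦ B(w) to FreeAbelianGroup ℂ
→+ FormalRep; five-term relators go to KZ.relations by FiveTermTransfer, [w]+[w̄] and [real]
relators go to 0 by the definition of B; value(ρ z) = ∫_{T z} t⁻³ by setIntegral_congr. Pure algebra
(FreeAbelianGroup.lift, AddSubgroup.closure_le). [difficulty: provable-now] [DupontSah1982,
KontsevichZagier2001]
#9 IdealTetraRepExists (support) — non-vacuity: for algebraic u, v, w (ccw) and interior algebraic
q, the prism(u,v,w) and the inner tetrahedron (q;u,v,w) carry KZ representations with integrand t⁻³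
that are IsRational (p = 1, q = X₂³): ℚ-semialgebraic domains (real-algebraic parameters are
ℚ-definable, KZSemialgebraicComplex + Tarski–Seidenberg) and finite volume (three cusps; ∫_h^∞ t⁻³ =
1/(2h²) integrable over the triangle). [difficulty: M] [KontsevichZagier2001, BenedettiPetronio1992,
BochnakCosteRoy1998]
#9 PachnerTwoTwo (support) — 2–2 move: for algebraic u, v, w, q on one circle (centre κ, radius R)
in ccw convex order, [prism(u,v,w)] + [prism(u,w,q)] − [prism(u,v,q)] − [prism(v,w,q)] ∈
KZ.relations (all above the common hemisphere, integrand t⁻³): both sides are a.e. the prism over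
the quadrilateral; needed by FiveTermTransfer in the 4-concyclic configurations. [difficulty:
provable-now] [DupontSah1982, KontsevichZagier2001]
#9 CyclicCalibration (support) — calibration of IsometryMove with an inversion: T(i) and T((1+i)/2)
(rational vertices; the same ideal tetrahedron relabelled by w ↦ 1/(1−w), which sends ∞,0,1,i to
0,1,∞,(1+i)/2) are KZ-equivalent; both have value Catalan's constant G = D(i) = 0.9159655942.
[difficulty: provable-now] [Milnor1982, Zagier2007Dilogarithm]
#9 FiveTermCalibration (support) — the five-term instance (x,y) = (i,2i), a 4-concyclic
configuration {∞,0,i,2i} with rational vertices: [T(i)] + [T((3+i)/5)] − [T(2i)] − [T((6+2i)/5)] ∈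
KZ.relations (y/x = 2 is real and drops); numerically D(i)+D((3+i)/5) = 0.915966+0.511666 = 1.427632
= 0.808598+0.619034 = D(2i)+D((6+2i)/5). Geometrically the pyramid with apex 1 over the ideal
quadrilateral (∞,0,i,2i), split along either diagonal. [difficulty: M] [Neumann1998,
Zagier2007Dilogarithm]
#9 ZagierDilogarithmConjecture (support; stmt-KontsevichZagierPeriods-10550) — OPEN CONJECTURE, the
sector's only transcendence input, NOT a proof target (do not staff; refuters welcome): Zagier's
conjecture (Neumann1998 §2.1 pp. 7–8: every rational linear relation among D₂ at algebraic arguments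
follows from D₂(z̄) = −D₂(z) and the five-term relation; vol injective on P(ℚ̄)⁻) in the
volume/ℤ-form that is verbatim TetraSector's inline hypothesis (ℤ-form ⇔ ℚ-form by unique
divisibility of P(ℚ̄), Neumann1998 Thm 2.10). [difficulty: open-problem] [Neumann1998,
Zagier2007Dilogarithm, Milnor1982]
#9 OffTetraSectorKernel (support; stmt-KontsevichZagierPeriods-10557) — NOT CLAIMED BY THIS ROUTE:
the kernel form with the tetrahedral value-relators adjoined, ∀ c, KZ.eval c = 0 → c ∈ KZ.relations
⊔ closure{Σ nᵢ•[ρ zᵢ] : ρ standard reps on T(z), zᵢ ∈ ℚ̄ ∩ ℍ⁺, Σ nᵢ value(ρ zᵢ) = 0}; implied by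
Conjecture 1, equivalent to its kernel form modulo TetraSector ∧ ZagierDilogarithmConjecture;
GPC-strength, do not staff. [difficulty: open-problem] [KontsevichZagier2001, HuberMullerStach2017,
Goncharov1999]
#1 Assembly (stmt-KontsevichZagierPeriods-10685) — TetraSector → ZagierDilogarithmConjecture →
OffTetraSectorKernel → KontsevichZagierPeriods, PROVED as the deciding theorem `closes` (rev 2;
axioms propext/Classical.choice/Quot.sound).

TWO-LAYER PLAN. FiveTermTransfer ⇐ GenericBipyramid (no 4 of {∞,0,1,x,y} concyclic: IsometryMove an
apex to ∞ + PachnerTwoThree + normalisation of the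
five pieces) → DegenerateConfigurations (4-concyclic: PachnerTwoTwo + one real term; 5-concyclic
trivial) → FiveTermTransfer (k = 2).
PachnerTwoThree ⇐ SetIdentity (a.e. equality of the two unions + null overlaps, pure semialgebraic
geometry) → FiniteDissection (iterated
domainAddRel with restrict) → PachnerTwoThree. Nothing filed now.

KILL CRITERIA. A refutation of FiveTermTransfer by an additive invariant of FormalRep vanishing on
the four move sets but not on a five-term combination
closes the route (`refuted:FiveTermTransfer`) AND is maximal information for route Neg (the calculus
would be weaker than scissors
congruence). A refutation of PachnerTwoThree / IsometryMove as stated is a formulation error: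
restate (sides/orientation), not close.
A ℚ-linear relation among D(z), z ∈ ℚ̄, outside the five-term span (¬hypothesis of TetraSector)
kills the SECTOR claim (pivot: keep
X₁ as an unconditional transfer theorem, drop X₂); it would also refute Zagier's conjecture in
print. Since rev 2 that hypothesis is the named item ZagierDilogarithmConjecture: a refuter's
¬ZagierDilogarithmConjecture breaks the route formally and the repair is the announced pivot (drop
X₂, keep X₁ = FiveTermTransfer/PachnerTwoThree/IsometryMove as transfer theorems);
¬OffTetraSectorKernel would refute Conjecture 1 itself (it is implied by the kernel form).
LowDimension-style completeness
proved for all of dimension ≤ 3 elsewhere would supersede the sector.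

NOT DECOMPOSED YET. The case analysis of FiveTermTransfer (generic bipyramid vs 4-concyclic vs
coincident terms) and the finite-dissection lemma (iterated
rule (1a)) are layer-2; the identification value ρ(z) = D(z) (Milnor; Lobachevsky function) is
deliberately kept OUT of every statement
(representations and set integrals only); the unconditional corollaries (rank-1 Bloch groups of
imaginary quadratic fields via
Borel + Suslin; distribution relations [zⁿ] = n Σ[ζz]) and the weight-n ladder (hyperbolic
(2n−1)-simplices, Goncharov1999) are not filed;
no Literature definition of the Bloch–Wigner function or of the pre-Bloch group is requested as a
prerequisite (inline ℤ-form instead).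

CHEAPEST FALSIFIER. (1) PSLQ/LLL on {D(z)} for the ~200 algebraic z of height ≤ 4 in ℍ⁺ modulo the
five-term span (kit job; a surviving integer relation
with small coefficients would make the TetraSector hypothesis suspect-false — none is expected:
Zagier/Neumann report no counterexample);
(2) `lean check` of a Monte-Carlo-backed proof attempt of FiveTermCalibration's set identity (four
rational tetrahedra): if the four
indicator functions do not balance a.e., the sign conventions of FiveTermTransfer are wrong. I ran
the real-arithmetic versions:
five-term in Neumann's form holds to 1e-15 at random points; the 2–3 and 2–2 indicator identities
had 0 mismatches in 4·10⁵ samples;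
|det Dg| = (g₃/t)³ to 1e-9.

NUMBERS. D(i) = G = 0.9159655942 (Catalan); D(e^{iπ/3}) = 1.0149416064 (regular ideal tetrahedron,
maximal); calibration: D(2i) = 0.8085983912,
D((3+i)/5) = 0.5116663986, D((6+2i)/5) = 0.6190336015. rank B(F)⊗ℚ = r₂(F) (Borel); B(ℚ(ζ_N))⊗ℚ has
rank φ(N)/2 (Milnor's conjecture =
injectivity of D there). Items at open: 10 (3 cruxes, 1 target, 5 support, 1 assembly). After the
glue-first repair (rev 3): 12 (3 cruxes, 1 target, 7 support incl. the two not-staffed open-problem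
items, 1 assembly); deciding theorem certified, cone clean (0 unproved deps).

DEFINITION REQUESTS. Wanted later (not prerequisites):
`Literature.NumberTheory.Transcendental.blochWignerDilog : ℂ → ℝ` with the fact vol T(z) = D(z)
(Milnor1982; Zagier2007Dilogarithm Ch. I §3) — the named open conjecture asked for at open now
exists IN THE ROUTE as the item ZagierDilogarithmConjecture (conjectures live in routes, not in
Literature; D-0027 §2.1 / rule 4b); cite-fact: P(ℚ̄) uniquely divisible (DupontSah1982 §5 + Suslin,
Neumann1998
Thm 2.10). Filed with `ledger workitem add --kind definition|cite` after open.

Novelty: Searches (2026-08-15; local searchd down, galaxy 0 rows for "five-term relation dilogarithm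
Kontsevich-Zagier period conjecture rules"):
crossref "Kontsevich-Zagier period conjecture hyperbolic volume scissors congruence" (8: Ayoub2015,
CressonViusos/ViuSos thesis, Mohanty 2003
doi:10.2140/agt.2003.3.1 'Regge symmetry is a scissors congruence', Baseilhac–Benedetti); crossref
"Zagier conjecture linear relations
dilogarithm algebraic arguments five term" (Zagier2007Dilogarithm, Calegari–Garoufalidis–Zagier
2023); zbMATH "Bloch-Wigner dilogarithm
scissors congruence period" (0); lit frontier KontsevichZagierPeriods --since 2021 (30 rows, none on
scissors congruence); materialised
and read: arXiv:alg-geom/9601021 pp. 5–7, arXiv:math/9712226 pp. 3–8,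
doi:10.1016/0022-4049(82)90035-4 §§1,3,5; plus the card's audit
(KZ2001 full-text grep hyperb|dilog|Dehn|scissor = 0; arXiv:1912.01751 §2.2).
Nearest prior art found: Goncharov1999 (volumes of ℚ̄-simplices are mixed Tate periods; scissors
congruence organised motivically;
predates the KZ rules), DupontSah1982 (P(ℍ³) ≅ P_ℂ⁻, five-term = 2–3 move, divisibility),
Neumann1998 (Zagier's conjecture = volume
injective on P(ℚ̄)⁻), Mohanty 2003 doi:10.2140/agt.2003.3.1 (an explicit constructive scissors
congruence for a dilogarithm identity),
CressonViusos2022 (semialgebraic Hilbert 3 reformulation, Euclidean, no hyperbolic sector).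
Delta: nobody points the two generators of ideal scissors congruence at KZ's rules: here BOTH are
literal instan  [refs: 10.2140/agt.2003.3.1, 10.1016/0022-4049(82, alg-geom/9601021, math/9712226, 1912.01751, doi:10.2140/agt.2003.3.1, doi:10.1016/0022-4049, Ayoub2015, Goncharov1999, DupontSah1982, Neumann1998, CressonViusos2022]

Barriers (technique_class: hyperbolic-scissors-congruence, bloch-sector, pachner): - technique_class: hyperbolic-scissors-congruence, bloch-sector, pachner
- Literature.Barriers.KontsevichZagierPeriods.kzConjecture_implies_oddZetaAlgIndep: evaded by
construction — no transcendence statement is proved; the sector's transcendence content is the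
explicit hypothesis of TetraSector (Zagier's conjecture), exactly as LowDimension imports Baker;
FiveTermTransfer/PachnerTwoThree/IsometryMove are 'motivic relation ⇒ KZ relation' statements, which
the strength barriers do not touch.
- Literature.Barriers.KontsevichZagierPeriods.kzConjecture_implies_twoPiI_log_algIndep: same —
nothing about independence of logarithms is claimed; weight-1 content stays in route LowDimension.
- Literature.Barriers.KontsevichZagierPeriods.kzConjecture_implies_ellipticPeriods_algIndep: not
engaged (mixed Tate sector only, no elliptic periods).
- Literature.Barriers.KontsevichZagierPeriods.noSemialgebraicPrimitive_inv_sub_two: structurally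
absent — the line uses NO Newton–Leibniz move; only domain additivity (1a) and change of variables
(2).
- Literature.Barriers.KontsevichZagierPeriods.cressonViuSos_prop_3_2: absent — the barrier kills
single global volume-preserving maps WITHOUT dissection in dimension ≥ 5; this line is dissection
(2–3 moves) in dimension 3.
- Literature.Barriers.KontsevichZagierPeriods.not_complete_of_undecidable: consistent — the word
problem of P(ℚ̄)⁻ presented by five-term relators is r.e., and the sector claim is conditional on a
transcendence hypothesis, so no decis

History (route lifecycle, newest last):
- 2026-08-15T16:21:05Z · rev 3: restated Assembly (stmt-KontsevichZagierPeriods-0197) — route-repair (staffability): after rev 2 the only unproved cone dep was Literature.NumberTheory.Transcendental.KZKernelConjecture [cite_only], entering solely t (planner-rbadge-KontsevichZagierPeriods-Hyperbo-70787ef0-g2-0)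
- 2026-08-16T00:23:13Z · rev 5: restated PachnerTwoThree (stmt-KontsevichZagierPeriods-3470 proved), IsometryMove (stmt-KontsevichZagierPeriods-3471 proved) — route-repair (glue-native-fail) rev 5: the deciding theorem was never wrong (glue.native.ok=true since 2026-08-15T16:19Z; re-certified today, binder form, concl (planner-rglue-KontsevichZagierPeriods-Hyperbo-70787ef0-0)
- 2026-08-16T02:17:47Z · AUTO-CRUX: 2 conjecture-grade item(s) promoted to crux (ZagierDilogarithmConjecture, OffTetraSectorKernel) — refuter vetting / tiering apply (operator:999:1362873)
- 2026-08-16T04:08:32Z · AUTO-CRUX (backfill): TetraSector — hypotheses of the deciding theorem that nothing in the route derives are cruxes (operator:999:1085951)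
- 2026-08-16T05:07:27Z · CLOSED exhausted — exhausted (planner-rbadge-KontsevichZagierPeriods-Hyperbo-70787ef0-g3-0)
- 2026-08-16T05:28:07Z · REOPENED (human ruling): remainder claimed as cruxes ZagierDilogarithmConjecture + OffTetraSectorKernel; TetraSector/FiveTermCalibration banked as proved (operator:gate4)
- 2026-08-23T21:53:36Z · DORMANT — reconciler: no traction for 6.3 d (last activity item-evidence-added at 2026-08-17T14:41:05Z); parked, not closed — `ledger route dormant route-KontsevichZagier (operator:999:702183)
- 2026-08-30T03:38:37Z · REACTIVATED — reconciler: reactivated — activity statement-attached at 2026-08-30T02:51:58Z after parking at 2026-08-23T21:53:36Z (operator:999:4078070)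

sub-problem: KontsevichZagierPeriods · status: open · opened planner-plancard-KontsevichZagierPeriods-Kont-82a49719-0 2026-08-15T11:18:25Z · rev 8 · ledger route-KontsevichZagierPeriods-HyperbolicBloch
GENERATED by the gate from the ledger (D-0016/17). Provers cite these decls: `theorem foo : Summit.KontsevichZagierPeriods.KontsevichZagierPeriods.Theses.HyperbolicBloch.<Decl> := …` in Summits/KontsevichZagierPeriods/KontsevichZagierPeriods/Theorems/<Name>.lean.
-/

namespace Summit.KontsevichZagierPeriods.KontsevichZagierPeriods.Theses.HyperbolicBloch

open scoped BigOperators Topology Manifold Classical MeasureTheory ProbabilityTheory Matrix InnerProductSpace ComplexConjugate ContinuousMap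
open Filter Set Function TopologicalSpace MeasureTheory

attribute [summit_statement] _root_.KontsevichZagierPeriods

open Literature Periods

/-- item stmt-KontsevichZagierPeriods-3468 · crux (kind.auto-crux: conjecture-grade) · rank 0 · closed · proved by Summit.KontsevichZagierPeriods.HyperbolicBloch.TetraSector.tetraSector_proof @ 94e53a4fb403 (prover) · by planner
why it might fail: the hypothesis (Zagier's conjecture ⊋ Goncharov Conj 2.8 ⊋ Milnor) could be false: a ℚ-relation among D at algebraic points outside the five-term span would make the target vacuous and, via GPC(MT, w ≤ 2), contradict the summit's motivic reading; none is known.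
sources: Neumann1998, Goncharov1999, Zagier2007Dilogarithm, Milnor1982, DupontSah1982
[target] Zagier's conjecture in volume/ℤ-form (hypothesis, inline: zᵢ ∈ ℚ̄ ∩ ℍ⁺, nᵢ ∈ ℤ, Σ nᵢ
∫_{T(zᵢ)} t⁻³ = 0 ⇒ Σ nᵢ[zᵢ] ∈ ℤ-span{five-term instances over ℚ̄ (Neumann's form
D(x)−D(y)+D(y/x)−D((1−x⁻¹)/(1−y⁻¹))+D((1−x)/(1−y))), [w]+[w̄], [real w]} in FreeAbelianGroup ℂ) ⇒
for every choice ρ of KZ reps on the standard tetrahedra T(z) (z algebraic, Im z > 0) with integrand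
t⁻³: Σ nᵢ·value(ρ zᵢ) = 0 ⇒ Σ nᵢ•[ρ zᵢ] ∈ KZ.relations (kernel form of Conjecture 1 on the
tetrahedral subgroup). -/
@[route_item "route-KontsevichZagierPeriods-HyperbolicBloch", crux]
def TetraSector : Prop :=
  ∀ (T : ℂ → Set (Fin 3 → ℝ)), (∀ z, T z = {p | 0 < p 1 ∧ z.re * p 1 < z.im * p 0 ∧ z.im * (p 0 - 1) < (z.re - 1) * p 1 ∧ 0 < p 2 ∧ 0 < z.im * (p 0 ^ 2 + p 1 ^ 2 + p 2 ^ 2 - p 0) + (z.re - Complex.normSq z) * p 1}) → (∀ (k : ℕ) (z : Fin k → ℂ) (n : Fin k → ℤ), (∀ i, IsAlgebraic ℚ (z i)) → (∀ i, 0 < (z i).im) → ∑ i, (n i : ℝ) * (∫ p in T (z i), 1 / p 2 ^ 3) = 0 → (∑ i, n i • FreeAbelianGroup.of (z i)) ∈ AddSubgroup.closure ({c : FreeAbelianGroup ℂ | ∃ x y : ℂ, IsAlgebraic ℚ x ∧ IsAlgebraic ℚ y ∧ x ≠ 0 ∧ x ≠ 1 ∧ y ≠ 0 ∧ y ≠ 1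 ∧ x ≠ y ∧ c = FreeAbelianGroup.of x - FreeAbelianGroup.of y + FreeAbelianGroup.of (y / x) - FreeAbelianGroup.of ((1 - x⁻¹) / (1 - y⁻¹)) + FreeAbelianGroup.of ((1 - x) / (1 - y))} ∪ {c | ∃ w : ℂ, IsAlgebraic ℚ w ∧ c = FreeAbelianGroup.of w + FreeAbelianGroup.of ((starRingEnd ℂ) w)} ∪ {c | ∃ w : ℂ, w.im = 0 ∧ c = FreeAbelianGroup.of w})) → ∀ (ρ : ℂ → Literature.NumberTheory.Transcendental.KZ.IntegralRep 3), (∀ z, IsAlgebraic ℚ z → 0 < z.im → (ρ z).domain = T z ∧ Set.EqOn (ρ z).integrand (fun p => 1 / p 2 ^ 3) (T z)) → ∀ (k : ℕ) (z : Fin k → ℂ) (n : Fin k → ℤ), (∀ i, IsAlgebraic ℚ (z i)) → (∀ i, 0 < (z i).im) → ∑ i, (n i : ℝ) * (ρ (z i)).value = 0 → (∑ i, n i • Literature.NumberTheory.Transcendental.KZ.of (ρ (z i))) ∈ Literature.NumberTheory.Transcendental.KZ.relations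

-- `TetraSector` holds: proved by `Summit.KontsevichZagierPeriods.HyperbolicBloch.TetraSector.tetraSector_proof` @ 94e53a4fb403 (its module imports this route file, so no `_holds` link can be stated here).

/-- item stmt-KontsevichZagierPeriods-3469 · crux · rank 2 · closed · proved by Summit.KontsevichZagierPeriods.HyperbolicBloch.FiveTerm.FiveTermTransfer_of @ dd808bc755f8 (prover) · by planner
why it might fail: only through the case analysis: a sign/orientation mismatch between the B(w̄) convention and the geometric 2-side/3-side in some degenerate (4-concyclic, coincident-term) configuration, or a non-null overlap; Dupont–Sah's P(∂ℍ³) ≅ P_ℂ⁻ (1982 §4, Rem. after 4.7) says every instance is geometric.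
sources: DupontSah1982, Neumann1998, Zagier2007Dilogarithm, KontsevichZagier2001
[crux] for algebraic x ≠ y in ℂ∖{0,1}: B(x) − B(y) + B(y/x) − B((1−x⁻¹)/(1−y⁻¹)) + B((1−x)/(1−y)) ∈
KZ.relations, where B(w) = [ρ w] (Im w > 0), −[ρ w̄] (Im w < 0), 0 (w real), ρ w any rep on T(w)
with integrand t⁻³ (card: 'THEOREM-CANDIDATE Transfer, weight 2'). Proof plan: the five terms are
the five sub-tetrahedra of {∞,0,1,x,y} ⊂ ∂ℍ³ (Dupont–Sah (5.3)); generic case = bipyramid: move an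
apex to ∞ by IsometryMove and apply PachnerTwoThree; 4-concyclic case = one real term +
PachnerTwoTwo after moving the fifth point to ∞; 5-concyclic = all terms zero; each piece is
normalised to a standard T(·) or its mirror by IsometryMove (ε = −1 gives [mirror of T(w̄)] =
B-convention). [deps: PachnerTwoThree, IsometryMove] [difficulty: L] -/
@[route_item "route-KontsevichZagierPeriods-HyperbolicBloch"]
def FiveTermTransfer : Prop :=
  ∀ (T : ℂ → Set (Fin 3 → ℝ)), (∀ z, T z = {p | 0 < p 1 ∧ z.re * p 1 < z.im * p 0 ∧ z.im * (p 0 - 1) < (z.re - 1) * p 1 ∧ 0 < p 2 ∧ 0 < z.im * (p 0 ^ 2 + p 1 ^ 2 + p 2 ^ 2 - p 0) + (z.re - Complex.normSq z) * p 1}) → ∀ (ρ : ℂ → Literature.NumberTheory.Transcendental.KZ.IntegralRep 3), (∀ z, IsAlgebraic ℚ z → 0 < z.im → (ρ z).domain = T z ∧ Set.EqOn (ρ z).integrand (fun p => 1 / p 2 ^ 3) (T z)) → ∀ (B : ℂ → Literature.NumberTheory.Transcendental.KZ.FormalRep), (∀ z, B z = if 0 < z.im then Literature.NumberTheory.Transcendental.KZ.of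 (ρ z) else if z.im < 0 then -Literature.NumberTheory.Transcendental.KZ.of (ρ ((starRingEnd ℂ) z)) else 0) → ∀ x y : ℂ, IsAlgebraic ℚ x → IsAlgebraic ℚ y → x ≠ 0 → x ≠ 1 → y ≠ 0 → y ≠ 1 → x ≠ y → B x - B y + B (y / x) - B ((1 - x⁻¹) / (1 - y⁻¹)) + B ((1 - x) / (1 - y)) ∈ Literature.NumberTheory.Transcendental.KZ.relations

-- `FiveTermTransfer` holds: proved by `Summit.KontsevichZagierPeriods.HyperbolicBloch.FiveTerm.FiveTermTransfer_of` @ dd808bc755f8 (its module imports this route file, so no `_holds` link can be stated here).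

/-- item stmt-KontsevichZagierPeriods-0540 · crux · rank 5 · open · by planner
why it might fail: A certificate for [π]⋆c may mix the two disc coordinates with c's by a change of variables, leaving no shadow certificate for c; the motivic shadow P̃(MM^eff_Nori)→P̃(MM_Nori) injective is printed OPEN (HuberWustholz2022 App A.4); one witness (Neg 11011 / 0542 shape) refutes it and the summit.
sources: HuberWustholz2022, AyoubRelKZRevisited, KontsevichZagier2001, HuberMullerStachPeriods2017, Ayoub2014
PiCancellation := ∀ c : Literature.NumberTheory.Transcendental.KZ.FormalRep, (of piRep) ⋆ c ∈
Literature.NumberTheory.Transcendental.KZ.relations → c ∈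
Literature.NumberTheory.Transcendental.KZ.relations, piRep = closed unit disc with integrand 1 (d =
2). A consequence of S (eval (piRep ⋆ c) = π · eval c by Fubini, π ≠ 0), but transcendence-free: it
is a regular-element property of the presented abelian group FormalRep/relations under the product,
and the exact point where Ayoub's relative theorem fails to be effective (AyoubRelKZRevisited Rem
1.3: the torsor exists only over D((2πi)⁻¹)) and where HuberMullerStach2017 §13 passes from P^eff to
P = P^eff[(2πi)⁻¹]. Independent of the chosen π-representation once `relations` is an ideal under ⋆
(part of the def request). Attack suggestions: (i) normal forms for ⋆-multiples of disc reps (the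
disc factor occupies two leading coordinates untouched by NL along the last coordinate; CoV may mix
them — the crux is whether a relation certificate for piRep ⋆ c can be 'projected' to one for c,
e.g. by restricting/fibrewise-specialising the disc coordinates at a rational point and using domain
additivity); (ii) small cases: c supported in dimensi -/
@[route_item "route-KontsevichZagierPeriods-HyperbolicBloch", crux]
def AyoubPiCancellation : Prop :=
  ∀ (P : ∀ n : ℕ, Literature.NumberTheory.Transcendental.KZ.IntegralRep n → Literature.NumberTheory.Transcendental.KZ.IntegralRep (n + 2)), (∀ (n : ℕ) (r : Literature.NumberTheory.Transcendental.KZ.IntegralRep n), (P n r).domain = {z : Fin (n + 2) → ℝ | z 0 ^ 2 + z 1 ^ 2 ≤ 1 ∧ (fun i : Fin n => z i.succ.succ) ∈ r.domain} ∧ (P n r).integrand = fun z => r.integrand (fun i : Fin n => z i.succ.succ)) → ∀ c : Literature.NumberTheory.Transcendental.KZ.FormalRep, FreeAbelianGroup.lift (fun s : (Σ n, Literature.NumberTheory.Transcendental.KZ.IntegralRep n) => Literature.NumberTheory.Transcendental.KZ.of (P s.1 s.2)) c ∈ Literature.NumberTheory.Transcendental.KZ.relations → c ∈ Literature.Numb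erTheory.Transcendental.KZ.relations

/-- item stmt-KontsevichZagierPeriods-0541 · crux · rank 6 · open · by planner
why it might fail: GPC-strength after inverting [π] (Ayoub2014 Conj 7): with 0540 it gives alg. independence of ζ(3), ζ(5), …; torsor methods yield Nori-side relations only, their transfer into the four moves (even with [π] inverted) is unproved; one value-0 combination resisting every [π]-power refutes it and S.
sources: Ayoub2014, HuberMullerStachPeriods2017, AyoubRelKZRevisited, KontsevichZagier2001, arXiv:1105.0865
PiLocalKernel := ∀ c : Literature.NumberTheory.Transcendental.KZ.FormalRep,
Literature.NumberTheory.Transcendental.KZ.eval c = 0 → ∃ N : ℕ, (of piRep)^⋆N ⋆ c ∈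
Literature.NumberTheory.Transcendental.KZ.relations. This is the half of S reachable by torsor
arguments: Grothendieck's period conjecture gives injectivity of P̃ = P̃^eff[(2πi)⁻¹] → ℂ (route
Grothendieck, 0279), and a transfer of Nori/cohomological relators into KZ.relations (route
NoriTransfer, 0194/0198) then yields (2πi)^{2N}·c = (−4π²)^N·c ∈ relations WITHOUT needing
injectivity of P̃^eff → P̃; Ayoub's rigid-analytic computation of the Betti–de Rham torsor
(Ayoub2015 §3.6, AyoubRelKZRevisited Thm 1.11) is the model argument and works precisely after
inverting 2πi. Open (≈ GPC-strength); filed so that provers/refuters see the effective/localised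
distinction explicitly and so that a proof of #2′ collapses the problem to this item.
[needs_definition: KZ.prodRep / piRep / PiLocalKernel (def request this session); sources:
AyoubRelKZRevisited, Ayoub2015, HuberMullerStach2017] -/
@[route_item "route-KontsevichZagierPeriods-HyperbolicBloch", crux]
def AyoubPiLocalKernel : Prop :=
  ∀ (P : ∀ n : ℕ, Literature.NumberTheory.Transcendental.KZ.IntegralRep n → Literature.NumberTheory.Transcendental.KZ.IntegralRep (n + 2)), (∀ (n : ℕ) (r : Literature.NumberTheory.Transcendental.KZ.IntegralRep n), (P n r).domain = {z : Fin (n + 2) → ℝ | z 0 ^ 2 + z 1 ^ 2 ≤ 1 ∧ (fun i : Fin n => z i.succ.succ) ∈ r.domain} ∧ (P n r).integrand = fun z => r.integrand (fun i : Fin n => z i.succ.succ)) → ∀ c : Literature.NumberTheory.Transcendental.KZ.FormalRep, Literature.NumberTheory.Transcendental.KZ.eval c = 0 → ∃ N : ℕ, (⇑(FreeAbelianGroup.lift (fun s : (Σ n, Literature.NumberTheory.Transcendental.KZ.IntegralRep n) => Literature.NumberTheory.Transcendental.KZ.of (P s.1 s.2))))^[N] c ∈ Literature.NumberTheory.Tr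anscendental.KZ.relations

/-- item stmt-KontsevichZagierPeriods-10550 · crux (kind.auto-crux: conjecture-grade) · rank 9 · open · by planner
why it might fail: auto-crux — conjecture-grade statement (name 'ZagierDilogarithmConjecture' says conjecture/hypothesis); it is open, so it may simply be false
sources: conjecture-registry
[support] OPEN CONJECTURE — the transcendence input of the sector; NOT a proof target (do not staff
provers on it; refuters welcome). Zagier's conjecture on linear relations among values of the
Bloch–Wigner dilogarithm at algebraic arguments (Neumann1998 §2.1, pp. 7–8: 'any rational linear
relation among values of D₂ at algebraic arguments must be a consequence of D₂(z̄) = −D₂(z) and the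
five-term functional relation'; 'differently expressed, the volume map is injective on P(ℚ̄)⁻'), in
the volume/ℤ-form that is VERBATIM the inline hypothesis of TetraSector: for algebraic zᵢ with Im zᵢ
> 0 and nᵢ ∈ ℤ, Σ nᵢ ∫_{T(zᵢ)} t⁻³ = 0 ⇒ Σ nᵢ[zᵢ] ∈ ℤ-span{five-term instances over ℚ̄ in Neumann's
form [x]−[y]+[y/x]−[(1−x⁻¹)/(1−y⁻¹)]+[(1−x)/(1−y)], [w]+[w̄] (w ∈ ℚ̄), [w] (w real)} in
FreeAbelianGroup ℂ. Here ∫_{T(z)} t⁻³ = vol T(z) = D(z) (Milnor1982), and the ℤ-form is equivalent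
to the printed ℚ-form because P(ℚ̄) is uniquely divisible (Neumann1998 Thm 2.10, after Suslin;
Dupont–Sah), so that P(ℚ̄)⁺ = ℤ-span{[u]+[ū]}. Filed as a route item by D-0027 §2.1 (a conjecture
the line leans on is an explicit antecedent of `closes`, never a Literature fact): `TetraSector T hT
(ZagierDilogarithmConjectur -/
@[route_item "route-KontsevichZagierPeriods-HyperbolicBloch", crux]
def ZagierDilogarithmConjecture : Prop :=
  ∀ (T : ℂ → Set (Fin 3 → ℝ)), (∀ z, T z = {p | 0 < p 1 ∧ z.re * p 1 < z.im * p 0 ∧ z.im * (p 0 - 1) < (z.re - 1) * p 1 ∧ 0 < p 2 ∧ 0 < z.im * (p 0 ^ 2 + p 1 ^ 2 + p 2 ^ 2 - p 0) + (z.re - Complex.normSq z) * p 1}) → ∀ (k : ℕ) (z : Fin k → ℂ) (n : Fin k → ℤ), (∀ i, IsAlgebraic ℚ (z i)) → (∀ i, 0 < (z i).im) → ∑ i, (n i : ℝ) * (∫ p in T (z i), 1 / p 2 ^ 3) = 0 → (∑ i, n i • FreeAbelianGroup.of (z i)) ∈ AddSubgroup.closure ({c : FreeAbelianGroup ℂ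 | ∃ x y : ℂ, IsAlgebraic ℚ x ∧ IsAlgebraic ℚ y ∧ x ≠ 0 ∧ x ≠ 1 ∧ y ≠ 0 ∧ y ≠ 1 ∧ x ≠ y ∧ c = FreeAbelianGroup.of x - FreeAbelianGroup.of y + FreeAbelianGroup.of (y / x) - FreeAbelianGroup.of ((1 - x⁻¹) / (1 - y⁻¹)) + FreeAbelianGroup.of ((1 - x) / (1 - y))} ∪ {c | ∃ w : ℂ, IsAlgebraic ℚ w ∧ c = FreeAbelianGroup.of w + FreeAbelianGroup.of ((starRingEnd ℂ) w)} ∪ {c | ∃ w : ℂ, w.im = 0 ∧ c = FreeAbelianGroup.of w})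

/-- item stmt-KontsevichZagierPeriods-10557 · crux (kind.auto-crux: conjecture-grade) · rank 9 · open · by planner
why it might fail: auto-crux — conjecture-grade statement (docstring avows it ('NOT CLAIMED BY THIS ROUTE')); it is open, so it may simply be false
sources: conjecture-registry
[support] NOT CLAIMED BY THIS ROUTE — the remainder of the summit given the tetrahedral sector
(idiom of OctahedralSymmetry.LevelFourSectorKernel / GammaCornerAnomaly.SummitOffMUMSector; D-0027
§2.1 glue-first): the kernel form of Conjecture 1 with the ℚ̄-ideal-tetrahedron value-relators
ADJOINED — for the standard tetrahedron family T, every formal combination c with eval c = 0 lies in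
KZ.relations ⊔ closure{Σ nᵢ•[ρ zᵢ] : ρ any choice of KZ representations on the T(z) (z ∈ ℚ̄, Im z >
0) with integrand t⁻³, zᵢ ∈ ℚ̄ ∩ ℍ⁺, nᵢ ∈ ℤ, Σ nᵢ·value(ρ zᵢ) = 0}. Trivially implied by
KZKernelConjecture (the adjoined set lies in ker eval, which is not named here so that no
PeriodConjecture.lean constant enters the route); modulo TetraSector ∧ ZagierDilogarithmConjecture
it is EQUIVALENT to KZKernelConjecture, and the deciding theorem `closes : TetraSector →
ZagierDilogarithmConjecture → OffTetraSectorKernel → KontsevichZagierPeriods` discharges each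
adjoined relator by TetraSector (AddSubgroup.closure_le, sup_le; KZ.eval_of on [r] − [r']). It is
Conjecture 1 with weight-2 hyperbolic volumes as an oracle — GPC-strength: the barriers
kzConjecture_implies_oddZetaAlgIndep / kzConjecture_implies_two -/
@[route_item "route-KontsevichZagierPeriods-HyperbolicBloch", crux]
def OffTetraSectorKernel : Prop :=
  ∀ (T : ℂ → Set (Fin 3 → ℝ)), (∀ z, T z = {p | 0 < p 1 ∧ z.re * p 1 < z.im * p 0 ∧ z.im * (p 0 - 1) < (z.re - 1) * p 1 ∧ 0 < p 2 ∧ 0 < z.im * (p 0 ^ 2 + p 1 ^ 2 + p 2 ^ 2 - p 0) + (z.re - Complex.normSq z) * p 1}) → ∀ c : Literature.NumberTheory.Transcendental.KZ.FormalRep, Literature.NumberTheory.Transcendental.KZ.eval c = 0 → c ∈ Literature.NumberTheory.Transcendental.KZ.relations ⊔ AddSubgroup.closure {d : Literature.NumberTheory.Transcendental.KZ.FormalRep | ∃ ρ : ℂ → Literature.NumberTheory.Transcendental.KZ.IntegralRep 3, (∀ z, IsAlgebraic ℚ z → 0 < z.im → (ρ z).domain = T z ∧ Set.EqOn (ρ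 z).integrand (fun p => 1 / p 2 ^ 3) (T z)) ∧ ∃ (k : ℕ) (z : Fin k → ℂ) (n : Fin k → ℤ), (∀ i, IsAlgebraic ℚ (z i)) ∧ (∀ i, 0 < (z i).im) ∧ ∑ i, (n i : ℝ) * (ρ (z i)).value = 0 ∧ d = ∑ i, n i • Literature.NumberTheory.Transcendental.KZ.of (ρ (z i))}

-- earlier PachnerTwoThree (stmt-KontsevichZagierPeriods-3470, replaced 2026-08-16T00:23:13Z -> stmt-KontsevichZagierPeriods-14098): proved by Summit.KontsevichZagierPeriods.HyperbolicBloch.PachnerTwoThree.PachnerTwoThree_of @ 61ccbcdcee5e — ∀ (L : ℂ → ℂ → (Fin 3 → ℝ) → ℝ), (∀ u v p, L u v p = (v.re - u.re) * (p 1 - u.im) - (v.im - u.im) * (p 0 - u.re)) → ∀ (S : ℂ → ℂ → ℂ → (Fin 3 → ℝ) → ℝ), (∀ u v w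
/-- item stmt-KontsevichZagierPeriods-14098 · support · rank 3 · closed · moot by None · by planner
why it might fail: Settled in tree (PachnerTwoThree_of: sorry-free, whitelist axioms). Residual risk is clerical: a port whose final type drifts from this verbatim body (binder order, the P-abbreviation hypothesis) is not matched by the probe; a closure from a cyclic module re-breaks the route file.
sources: DupontSah1982, BenedettiPetronio1992, KontsevichZagier2001, lean:Summit.KontsevichZagierPeriods.HyperbolicBloch.PachnerTwoThree.PachnerTwoThree_of
[crux — PORT ONLY, mathematically SETTLED] rev-5 re-issue of stmt-KontsevichZagierPeriods-3470 with
an Expr-identical statement (explicit binder annotations only; planner Scratch.lean: `rfl` with the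
rev-4 decl, and the committed proof elaborates against this body). Route-repair 2026-08-16
(glue-native-fail): stmt-3470 is PROVED —
Summit.KontsevichZagierPeriods.HyperbolicBloch.PachnerTwoThree.PachnerTwoThree_of
(Theorems/HyperbolicBlochPachnerTwoThree.lean + …Pointwise/…Scaffold, line
exchange-identity-symmdiff, closed 2026-08-16T00:07Z @ 1b876a73) — but those modules import THIS
Theses file and the gate links a closure by importing the prover's module INTO this file ⇒ import
cycle ⇒ every decl 'has already been declared' ⇒ route unmaterialisable (same failure class as
ThermalWedge rev 2 / PhotonSphereChannels rev 4). PROVERS: DO NOT `workitem close` this item --by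
any theorem whose module (transitively) imports
Summits.KontsevichZagierPeriods.KontsevichZagierPeriods.Theses.HyperbolicBloch — that re-freezes the
route. WANTED (mechanical port, ≈660 lines already written): CYCLE-FREE module(s)
Theorems/HyperbolicBlochPachnerTwoThreeFree*.lean importing only Mathlib / Literature.* / S -/
@[route_item "route-KontsevichZagierPeriods-HyperbolicBloch"]
def PachnerTwoThree : Prop :=
  ∀ (L : ℂ → ℂ → (Fin 3 → ℝ) → ℝ), (∀ (u v : ℂ) (p : Fin 3 → ℝ), L u v p = (v.re - u.re) * (p 1 - u.im) - (v.im - u.im) * (p 0 - u.re)) → ∀ (S : ℂ → ℂ → ℂ → (Fin 3 → ℝ) → ℝ), (∀ (u v w : ℂ) (p : Fin 3 → ℝ), S u v w p = (p 0 ^ 2 + p 1 ^ 2 + p 2 ^ 2) * (u.re * (v.im - w.im) - u.im * (v.re - w.re) + (v.re * w.im - v.im * w.re)) - p 0 * (Complex.normSq u * (v.im - w.im) - u.im * (Complex.normSq v - Complex.normSq w) + (Complex.normSq v * w.im - v.im * Complex.normSq w)) + p 1 * (Complex.normSq u * (v.re - w.re) - u.re * (Complex.normSq v - Complex.normSq w)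 + (Complex.normSq v * w.re - v.re * Complex.normSq w)) - (Complex.normSq u * (v.re * w.im - v.im * w.re) - u.re * (Complex.normSq v * w.im - v.im * Complex.normSq w) + u.im * (Complex.normSq v * w.re - v.re * Complex.normSq w))) → ∀ (P : ℂ → ℂ → ℂ → Set (Fin 3 → ℝ)), (∀ (u v w : ℂ), P u v w = {p | 0 < p 2 ∧ 0 < L u v p ∧ 0 < L v w p ∧ 0 < L w u p ∧ 0 < S u v w p}) → ∀ (u v w q : ℂ), IsAlgebraic ℚ u → IsAlgebraic ℚ v → IsAlgebraic ℚ w → IsAlgebraic ℚ q → 0 < L u v ![q.re, q.im, 0] → 0 < L v w ![q.re, q.im, 0] → 0 < L w u ![q.re, q.im, 0] → ∀ (rP rI r₁ r₂ r₃ : Literature.NumberTheory.Transcendental.KZ.IntegralRep 3), rP.domain = P u v w → rI.domain = {p | 0 < p 2 ∧ S u v w p < 0 ∧ 0 < S u v q p ∧ 0 < S v w q p ∧ 0 < S w u q p} → r₁.domain = P u v q → r₂.domain = P v w q → r₃.domain = P w u q → Set.EqOn rP.integrand (fun p => 1 / p 2 ^ 3) rP.domain → Set.EqOn rI.integrand (fun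 p => 1 / p 2 ^ 3) rI.domain → Set.EqOn r₁.integrand (fun p => 1 / p 2 ^ 3) r₁.domain → Set.EqOn r₂.integrand (fun p => 1 / p 2 ^ 3) r₂.domain → Set.EqOn r₃.integrand (fun p => 1 / p 2 ^ 3) r₃.domain → Literature.NumberTheory.Transcendental.KZ.of rP + Literature.NumberTheory.Transcendental.KZ.of rI - Literature.NumberTheory.Transcendental.KZ.of r₁ - Literature.NumberTheory.Transcendental.KZ.of r₂ - Literature.NumberTheory.Transcendental.KZ.of r₃ ∈ Literature.NumberTheory.Transcendental.KZ.relations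

-- earlier IsometryMove (stmt-KontsevichZagierPeriods-3471, replaced 2026-08-16T00:23:13Z -> stmt-KontsevichZagierPeriods-14099): proved by Summit.KontsevichZagierPeriods.HyperbolicBloch.IsometryMove.isometryMove_proof — ∀ (a b c d : ℂ) (ε : ℝ), IsAlgebraic ℚ a → IsAlgebraic ℚ b → IsAlgebraic ℚ c → IsAlgebraic ℚ d → a * d - b * c ≠ 0 → (ε = 1 ∨ ε = -1) → ∀ (g : (Fin 3 → ℝ) → (Fin 3 → ℝ)), (∀ p, g p =
/-- item stmt-KontsevichZagierPeriods-14099 · support · rank 4 · closed · moot by None · by planner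
why it might fail: Settled in tree (isometryMove_proof: sorry-free, whitelist axioms). Residual risk is clerical: the port must restate this body verbatim (g by its defining equation, ε = ±1 as a disjunction) in a module not importing the Theses file; a cyclic closure re-breaks the route file.
sources: BenedettiPetronio1992, KontsevichZagier2001, BochnakCosteRoy1998, lean:Summit.KontsevichZagierPeriods.HyperbolicBloch.IsometryMove.isometryMove_proof
[crux — PORT ONLY, mathematically SETTLED] rev-5 re-issue of stmt-KontsevichZagierPeriods-3471 with
an Expr-identical statement (explicit binder annotations only; planner Scratch.lean: `rfl` with the
rev-4 decl; the committed proof elaborates against this body). Route-repair 2026-08-16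
(glue-native-fail): stmt-3471 is PROVED —
Summit.KontsevichZagierPeriods.HyperbolicBloch.IsometryMove.isometryMove_proof
(Theorems/HyperbolicBlochIsometryMove.lean +
…Similarity/…Inversion/…Transport/…Factorisation/…AffineCase, line bruhat-inversion-chain) — but
those modules import THIS Theses file, and the gate links a closure by importing the prover's module
INTO this file ⇒ import cycle ⇒ 'has already been declared' ⇒ route unmaterialisable. PROVERS: DO
NOT `workitem close` this item --by any theorem whose module (transitively) imports
Summits.KontsevichZagierPeriods.KontsevichZagierPeriods.Theses.HyperbolicBloch. WANTED (mechanical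
port, ≈840 lines already written): CYCLE-FREE module(s)
Theorems/HyperbolicBlochIsometryMoveFree*.lean importing only Mathlib / Literature.* /
Summits.KontsevichZagierPeriods.Statement (the sub-files use no Theses decl — only their import line
changes), ending in a th -/
@[route_item "route-KontsevichZagierPeriods-HyperbolicBloch"]
def IsometryMove : Prop :=
  ∀ (a b c d : ℂ) (ε : ℝ), IsAlgebraic ℚ a → IsAlgebraic ℚ b → IsAlgebraic ℚ c → IsAlgebraic ℚ d → a * d - b * c ≠ 0 → (ε = 1 ∨ ε = -1) → ∀ (g : (Fin 3 → ℝ) → (Fin 3 → ℝ)), (∀ p : Fin 3 → ℝ, g p = ![((a * (Complex.mk (p 0) (ε * p 1)) + b) * (starRingEnd ℂ) (c * (Complex.mk (p 0) (ε * p 1)) + d) + a * (starRingEnd ℂ) c * (p 2 : ℂ) ^ 2).re / (Complex.normSq (c * (Complex.mk (p 0) (ε * p 1)) + d) + Complex.normSq c * p 2 ^ 2), ((a * (Complex.mk (p 0) (ε * p 1)) + b) * (starRingEnd ℂ) (c * (Complex.mk (p 0) (ε * p 1)) + d) + a * (starRingEnd ℂ) c * (p 2 : ℂ) ^ 2).im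 / (Complex.normSq (c * (Complex.mk (p 0) (ε * p 1)) + d) + Complex.normSq c * p 2 ^ 2), ‖a * d - b * c‖ * p 2 / (Complex.normSq (c * (Complex.mk (p 0) (ε * p 1)) + d) + Complex.normSq c * p 2 ^ 2)]) → ∀ (r r' : Literature.NumberTheory.Transcendental.KZ.IntegralRep 3), r.domain ⊆ {p : Fin 3 → ℝ | 0 < p 2} → Set.EqOn r.integrand (fun p : Fin 3 → ℝ => 1 / p 2 ^ 3) r.domain → r'.domain = g '' r.domain → Set.EqOn r'.integrand (fun p : Fin 3 → ℝ => 1 / p 2 ^ 3) r'.domain → Literature.NumberTheory.Transcendental.KZ.Equivalent r r'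

/-- item stmt-KontsevichZagierPeriods-18247 · support · rank 9 · closed · proved by Summit.KontsevichZagierPeriods.HyperbolicBloch.OffTetraSectorKernel.PiSplit.offTetraSectorKernelPiSplitGlue_proof @ 36724edd3f20 (prover) · by planner
[support] GLUE of the crux-strategist's [π]-SPLIT of OffTetraSectorKernel (BC2 redirect re-exam,
2026-08-17; Kontsevich–Zagier 2001 §4.1 P̂ = P[(2πi)⁻¹] read in both directions; Ayoub2014 Def. 6 /
Conj. 7): AyoubPiLocalKernel (child 1 = item stmt-0541 verbatim) → AyoubPiCancellation (child 2 =
item stmt-0540 verbatim) → OffTetraSectorKernel. PROVED sorry-free against the tree — planner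
evidence HyperbolicBlochOffTetraSectorKernelSplit.lean on stmt-10557
(PiSplit.offTetraSectorKernel_of_subs: lean check rc 0, 0 sorry, axioms
propext/Classical.choice/Quot.sound): the pinned family P n r = [unit disc] × r exists
(BetaCancellationLine.exists_pinned), child 1 gives (lift (of ∘ P))^[N] c ∈ KZ.relations for every c
of value 0, child 2 peels the N factors one at a time (induction on N), and the kernel form lands in
the left summand KZ.relations ≤ KZ.relations ⊔ closure(tetra relators). Summits/Theorems is
prover-only (perm.theorems-prover-only), so a prover lands that file verbatim as
Theorems/HyperbolicBlochOffTetraSectorKernelSplit.lean and closes THIS item with the one-liner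
`theorem offTetraSectorKernelPiSplitGlue_proof : HyperbolicBloch.OffTetraSectorKernelPiSplitGlue :=
PiSplit.offTe -/
@[route_item "route-KontsevichZagierPeriods-HyperbolicBloch"]
def OffTetraSectorKernelPiSplitGlue : Prop :=
  (∀ (P : ∀ n : ℕ, Literature.NumberTheory.Transcendental.KZ.IntegralRep n → Literature.NumberTheory.Transcendental.KZ.IntegralRep (n + 2)), (∀ (n : ℕ) (r : Literature.NumberTheory.Transcendental.KZ.IntegralRep n), (P n r).domain = {z : Fin (n + 2) → ℝ | z 0 ^ 2 + z 1 ^ 2 ≤ 1 ∧ (fun i : Fin n => z i.succ.succ) ∈ r.domain} ∧ (P n r).integrand = fun z => r.integrand (fun i : Fin n => z i.succ.succ)) → ∀ c : Literature.NumberTheory.Transcendental.KZ.FormalRep, Literature.NumberTheory.Transcendental.KZ.eval c = 0 → ∃ N : ℕ, (⇑(FreeAbelianGroup.lift (fun s : (Σ n, Literature.NumberTheory.Transcendental.KZ.IntegralRep n) => Literature.NumberTheory.Transcendental.KZ.of (P s.1 s.2))))^[N] c ∈ Literature.NumberTheory.Transcendental.KZ.relations) → (∀ (P : ∀ n : ℕ,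 Literature.NumberTheory.Transcendental.KZ.IntegralRep n → Literature.NumberTheory.Transcendental.KZ.IntegralRep (n + 2)), (∀ (n : ℕ) (r : Literature.NumberTheory.Transcendental.KZ.IntegralRep n), (P n r).domain = {z : Fin (n + 2) → ℝ | z 0 ^ 2 + z 1 ^ 2 ≤ 1 ∧ (fun i : Fin n => z i.succ.succ) ∈ r.domain} ∧ (P n r).integrand = fun z => r.integrand (fun i : Fin n => z i.succ.succ)) → ∀ c : Literature.NumberTheory.Transcendental.KZ.FormalRep, FreeAbelianGroup.lift (fun s : (Σ n, Literature.NumberTheory.Transcendental.KZ.IntegralRep n) => Literature.NumberTheory.Transcendental.KZ.of (P s.1 s.2)) c ∈ Literature.NumberTheory.Transcendental.KZ.relations → c ∈ Literature.NumberTheory.Transcendental.KZ.relations) → OffTetraSectorKernel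

-- `OffTetraSectorKernelPiSplitGlue` holds: proved by `Summit.KontsevichZagierPeriods.HyperbolicBloch.OffTetraSectorKernel.PiSplit.offTetraSectorKernelPiSplitGlue_proof` @ 36724edd3f20 (its module imports this route file, so no `_holds` link can be stated here).

/-- item stmt-KontsevichZagierPeriods-3472 · support · rank 9 · closed · proved by Summit.KontsevichZagierPeriods.HyperbolicBloch.SectorReduction.sectorReduction_proof @ 31d24f455146 (prover) · by planner
sources: DupontSah1982, KontsevichZagier2001
[support] FiveTermTransfer → TetraSector: lift w ↦ B(w) to FreeAbelianGroup ℂ →+ FormalRep;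
five-term relators go to KZ.relations by FiveTermTransfer, [w]+[w̄] and [real] relators go to 0 by
the definition of B; value(ρ z) = ∫_{T z} t⁻³ by setIntegral_congr. Pure algebra
(FreeAbelianGroup.lift, AddSubgroup.closure_le). [difficulty: provable-now] -/
@[route_item "route-KontsevichZagierPeriods-HyperbolicBloch"]
def SectorReduction : Prop :=
  FiveTermTransfer → TetraSector

-- `SectorReduction` holds: proved by `Summit.KontsevichZagierPeriods.HyperbolicBloch.SectorReduction.sectorReduction_proof` @ 31d24f455146 (its module imports this route file, so no `_holds` link can be stated here).

/-- item stmt-KontsevichZagierPeriods-3473 · support · rank 9 · closed · proved by Summit.KontsevichZagierPeriods.HyperbolicBloch.IdealTetraRep.idealTetraRepExists_proof (prover) · by planner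
sources: KontsevichZagier2001, BenedettiPetronio1992, BochnakCosteRoy1998
[support] non-vacuity: for algebraic u, v, w (ccw) and interior algebraic q, the prism(u,v,w) and
the inner tetrahedron (q;u,v,w) carry KZ representations with integrand t⁻³ that are IsRational (p =
1, q = X₂³): ℚ-semialgebraic domains (real-algebraic parameters are ℚ-definable,
KZSemialgebraicComplex + Tarski–Seidenberg) and finite volume (three cusps; ∫_h^∞ t⁻³ = 1/(2h²)
integrable over the triangle). [difficulty: M] -/
@[route_item "route-KontsevichZagierPeriods-HyperbolicBloch"]
def IdealTetraRepExists : Prop :=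
  ∀ (L : ℂ → ℂ → (Fin 3 → ℝ) → ℝ), (∀ u v p, L u v p = (v.re - u.re) * (p 1 - u.im) - (v.im - u.im) * (p 0 - u.re)) → ∀ (S : ℂ → ℂ → ℂ → (Fin 3 → ℝ) → ℝ), (∀ u v w p, S u v w p = (p 0 ^ 2 + p 1 ^ 2 + p 2 ^ 2) * (u.re * (v.im - w.im) - u.im * (v.re - w.re) + (v.re * w.im - v.im * w.re)) - p 0 * (Complex.normSq u * (v.im - w.im) - u.im * (Complex.normSq v - Complex.normSq w) + (Complex.normSq v * w.im - v.im * Complex.normSq w)) + p 1 * (Complex.normSq u * (v.re - w.re) - u.re * (Complex.normSq v - Complex.normSq w) + (Complex.normSq v * w.re - v.re * Complex.normSq w)) - (Complex.normSq u * (v.re * w.im - v.im * w.re) - u.re * (Complex.normSq v * w.im - v.im * Complex.normSq w) + u.im * (Complex.normSq v * w.re - v.re * Complex.normSq w))) → ∀ (u v w q : ℂ), IsAlgebraic ℚ u → IsAlgebraic ℚ v → IsAlgebraic ℚ w → IsAlgebraic ℚ q → 0 < L u v ![w.re, w.im, 0] → (∃ r : Literature.NumberTheory.Transcendental.KZ.IntegralRep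 3, r.domain = {p | 0 < p 2 ∧ 0 < L u v p ∧ 0 < L v w p ∧ 0 < L w u p ∧ 0 < S u v w p} ∧ Set.EqOn r.integrand (fun p => 1 / p 2 ^ 3) r.domain ∧ r.IsRational) ∧ (0 < L u v ![q.re, q.im, 0] → 0 < L v w ![q.re, q.im, 0] → 0 < L w u ![q.re, q.im, 0] → ∃ r : Literature.NumberTheory.Transcendental.KZ.IntegralRep 3, r.domain = {p | 0 < p 2 ∧ S u v w p < 0 ∧ 0 < S u v q p ∧ 0 < S v w q p ∧ 0 < S w u q p} ∧ Set.EqOn r.integrand (fun p => 1 / p 2 ^ 3) r.domain ∧ r.IsRational)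

-- `IdealTetraRepExists` holds: proved by `Summit.KontsevichZagierPeriods.HyperbolicBloch.IdealTetraRep.idealTetraRepExists_proof` (its module imports this route file, so no `_holds` link can be stated here).

/-- item stmt-KontsevichZagierPeriods-3474 · support · rank 9 · closed · proved by Summit.KontsevichZagierPeriods.HyperbolicBloch.PachnerTwoTwo.pachnerTwoTwo_proof @ 352fc55c30bb (prover) · by planner
sources: DupontSah1982, KontsevichZagier2001
[support] 2–2 move: for algebraic u, v, w, q on one circle (centre κ, radius R) in ccw convex order,
[prism(u,v,w)] + [prism(u,w,q)] − [prism(u,v,q)] − [prism(v,w,q)] ∈ KZ.relations (all above the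
common hemisphere, integrand t⁻³): both sides are a.e. the prism over the quadrilateral; needed by
FiveTermTransfer in the 4-concyclic configurations. [difficulty: provable-now] -/
@[route_item "route-KontsevichZagierPeriods-HyperbolicBloch"]
def PachnerTwoTwo : Prop :=
  ∀ (L : ℂ → ℂ → (Fin 3 → ℝ) → ℝ), (∀ u v p, L u v p = (v.re - u.re) * (p 1 - u.im) - (v.im - u.im) * (p 0 - u.re)) → ∀ (κ : ℂ) (R : ℝ) (P : ℂ → ℂ → ℂ → Set (Fin 3 → ℝ)), (∀ u v w, P u v w = {p | 0 < p 2 ∧ 0 < L u v p ∧ 0 < L v w p ∧ 0 < L w u p ∧ R ^ 2 < (p 0 - κ.re) ^ 2 + (p 1 - κ.im) ^ 2 + p 2 ^ 2}) → ∀ (u v w q : ℂ), IsAlgebraic ℚ u → IsAlgebraic ℚ v → IsAlgebraic ℚ w → IsAlgebraic ℚ q → ‖u - κ‖ = R → ‖v - κ‖ = R → ‖w - κ‖ = R → ‖q - κ‖ = R → 0 < L u v ![w.re, w.im, 0] → 0 < L u w ![q.re, q.im, 0] → 0 < L v w ![q.re, q.im, 0] → ∀ (r₁ r₂ r₃ r₄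 : Literature.NumberTheory.Transcendental.KZ.IntegralRep 3), r₁.domain = P u v w → r₂.domain = P u w q → r₃.domain = P u v q → r₄.domain = P v w q → Set.EqOn r₁.integrand (fun p => 1 / p 2 ^ 3) r₁.domain → Set.EqOn r₂.integrand (fun p => 1 / p 2 ^ 3) r₂.domain → Set.EqOn r₃.integrand (fun p => 1 / p 2 ^ 3) r₃.domain → Set.EqOn r₄.integrand (fun p => 1 / p 2 ^ 3) r₄.domain → Literature.NumberTheory.Transcendental.KZ.of r₁ + Literature.NumberTheory.Transcendental.KZ.of r₂ - Literature.NumberTheory.Transcendental.KZ.of r₃ - Literature.NumberTheory.Transcendental.KZ.of r₄ ∈ Literature.NumberTheory.Transcendental.KZ.relations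

-- `PachnerTwoTwo` holds: proved by `Summit.KontsevichZagierPeriods.HyperbolicBloch.PachnerTwoTwo.pachnerTwoTwo_proof` @ 352fc55c30bb (its module imports this route file, so no `_holds` link can be stated here).

/-- item stmt-KontsevichZagierPeriods-3475 · support · rank 9 · closed · proved by Summit.KontsevichZagierPeriods.HyperbolicBloch.CyclicCalibration.cyclicCalibration (prover) · by planner
sources: Milnor1982, Zagier2007Dilogarithm
[support] calibration of IsometryMove with an inversion: T(i) and T((1+i)/2) (rational vertices; the
same ideal tetrahedron relabelled by w ↦ 1/(1−w), which sends ∞,0,1,i to 0,1,∞,(1+i)/2) are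
KZ-equivalent; both have value Catalan's constant G = D(i) = 0.9159655942. [difficulty:
provable-now] -/
@[route_item "route-KontsevichZagierPeriods-HyperbolicBloch"]
def CyclicCalibration : Prop :=
  ∀ (r r' : Literature.NumberTheory.Transcendental.KZ.IntegralRep 3), r.domain = {p | 0 < p 1 ∧ 0 < p 0 ∧ p 0 - 1 < -p 1 ∧ 0 < p 2 ∧ 0 < p 0 ^ 2 + p 1 ^ 2 + p 2 ^ 2 - p 0 - p 1} → r'.domain = {p | 0 < p 1 ∧ p 1 < p 0 ∧ p 0 - 1 < -p 1 ∧ 0 < p 2 ∧ 0 < p 0 ^ 2 + p 1 ^ 2 + p 2 ^ 2 - p 0} → Set.EqOn r.integrand (fun p => 1 / p 2 ^ 3) r.domain → Set.EqOn r'.integrand (fun p => 1 / p 2 ^ 3) r'.domain → Literature.NumberTheory.Transcendental.KZ.Equivalent r r'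

/-- `CyclicCalibration` holds: proved by `Summit.KontsevichZagierPeriods.HyperbolicBloch.CyclicCalibration.cyclicCalibration`. -/
theorem CyclicCalibration_holds : CyclicCalibration := _root_.Summit.KontsevichZagierPeriods.HyperbolicBloch.CyclicCalibration.cyclicCalibration

/-- item stmt-KontsevichZagierPeriods-3476 · support · rank 9 · closed · proved by Summit.KontsevichZagierPeriods.HyperbolicBloch.Calibration.fiveTermCalibration_proof @ 9e9b6d155ff5 (prover) · by planner
sources: Neumann1998, Zagier2007Dilogarithm
[support] the five-term instance (x,y) = (i,2i), a 4-concyclic configuration {∞,0,i,2i} with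
rational vertices: [T(i)] + [T((3+i)/5)] − [T(2i)] − [T((6+2i)/5)] ∈ KZ.relations (y/x = 2 is real
and drops); numerically D(i)+D((3+i)/5) = 0.915966+0.511666 = 1.427632 = 0.808598+0.619034 =
D(2i)+D((6+2i)/5). Geometrically the pyramid with apex 1 over the ideal quadrilateral (∞,0,i,2i),
split along either diagonal. [difficulty: M] -/
@[route_item "route-KontsevichZagierPeriods-HyperbolicBloch"]
def FiveTermCalibration : Prop :=
  ∀ (r₁ r₂ r₃ r₄ : Literature.NumberTheory.Transcendental.KZ.IntegralRep 3), r₁.domain = {p | 0 < p 1 ∧ 0 < p 0 ∧ p 0 - 1 < -p 1 ∧ 0 < p 2 ∧ 0 < p 0 ^ 2 + p 1 ^ 2 + p 2 ^ 2 - p 0 - p 1} → r₂.domain = {p | 0 < p 1 ∧ 3 * p 1 < p 0 ∧ p 0 - 1 < -2 * p 1 ∧ 0 < p 2 ∧ 0 < p 0 ^ 2 + p 1 ^ 2 + p 2 ^ 2 - p 0 + p 1} → r₃.domain = {p | 0 < p 1 ∧ 0 < p 0 ∧ 2 * p 0 - 2 < -p 1 ∧ 0 < p 2 ∧ 0 <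 p 0 ^ 2 + p 1 ^ 2 + p 2 ^ 2 - p 0 - 2 * p 1} → r₄.domain = {p | 0 < p 1 ∧ 3 * p 1 < p 0 ∧ 2 * p 0 - 2 < p 1 ∧ 0 < p 2 ∧ 0 < p 0 ^ 2 + p 1 ^ 2 + p 2 ^ 2 - p 0 - p 1} → Set.EqOn r₁.integrand (fun p => 1 / p 2 ^ 3) r₁.domain → Set.EqOn r₂.integrand (fun p => 1 / p 2 ^ 3) r₂.domain → Set.EqOn r₃.integrand (fun p => 1 / p 2 ^ 3) r₃.domain → Set.EqOn r₄.integrand (fun p => 1 / p 2 ^ 3) r₄.domain → Literature.NumberTheory.Transcendental.KZ.of r₁ + Literature.NumberTheory.Transcendental.KZ.of r₂ - Literature.NumberTheory.Transcendental.KZ.of r₃ - Literature.NumberTheory.Transcendental.KZ.of r₄ ∈ Literature.NumberTheory.Transcendental.KZ.relations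

-- `FiveTermCalibration` holds: proved by `Summit.KontsevichZagierPeriods.HyperbolicBloch.Calibration.fiveTermCalibration_proof` @ 9e9b6d155ff5 (its module imports this route file, so no `_holds` link can be stated here).

-- earlier Assembly (stmt-KontsevichZagierPeriods-0197, replaced 2026-08-15T16:21:05Z -> stmt-KontsevichZagierPeriods-10685): proved by Summit.KontsevichZagierPeriods.KernelForm.kernel_implies_statement — (∀ c : Literature.NumberTheory.Transcendental.KZ.FormalRep, Literature.NumberTheory.Transcendental.KZ.eval c = 0 → c ∈ Literature.NumberTheory.Transcendental.KZ.relations) → KontsevichZagierPeriods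
/-- item stmt-KontsevichZagierPeriods-10685 · assembly · rank 1 · closed · proved by Summit.KontsevichZagierPeriods.HyperbolicBloch.assembly_proof (prover) · by planner
sources: KontsevichZagier2001, HuberMullerStach2017
[assembly] TetraSector → ZagierDilogarithmConjecture → OffTetraSectorKernel →
KontsevichZagierPeriods: unfold the summit to [r] − [r'] ∈ KZ.relations given KZ.eval ([r] − [r']) =
0 (KZ.eval_of), apply OffTetraSectorKernel for the standard tetrahedron family T (rfl), and
discharge each adjoined tetrahedral value-relator by TetraSector fed with
ZagierDilogarithmConjecture (sup_le, AddSubgroup.closure_le). PROVED as the deciding theorem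
`closes` of this file (rev 2; axioms propext, Classical.choice, Quot.sound) — a prover may land
`theorem assembly_holds : Assembly := closes` in Theorems at any time. Replaces, for THIS route
only, the shared kernel step stmt-KontsevichZagierPeriods-0197 (KZKernelConjecture → summit, proved
in Theorems/KernelFormKernelImpliesStatement.lean), so that no decl of this route names the open
conjecture KZKernelConjecture and the dependency cone is clean (staffability). [difficulty:
provable-now] [sources: KontsevichZagier2001, HuberMullerStach2017] -/
@[route_item "route-KontsevichZagierPeriods-HyperbolicBloch"]
def Assembly : Prop :=
  TetraSector → ZagierDilogarithmConjecture → OffTetraSectorKernel → KontsevichZagierPeriods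

-- `Assembly` holds: proved by `Summit.KontsevichZagierPeriods.HyperbolicBloch.assembly_proof` (its module imports this route file, so no `_holds` link can be stated here).

/-! D-0027 §2.1 — DECIDING THEOREM (planner-authored via `route open/edit --closes-file`; by planner-rglue-KontsevichZagierPeriods-Hyperbo-70787ef0-0 2026-08-16T00:23:13Z):
its hypotheses are this route's items and its conclusion the sub-problem Statement (glue_lint), and it elaborates with this file. -/

@[closes "route-KontsevichZagierPeriods-HyperbolicBloch"] theorem closes (hS : TetraSector) (hZ : ZagierDilogarithmConjecture) (hO : OffTetraSectorKernel) :
    _root_.KontsevichZagierPeriods := by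
  intro n m r r' _ _ hv
  have h0 : Literature.NumberTheory.Transcendental.KZ.eval
      (Literature.NumberTheory.Transcendental.KZ.of r - Literature.NumberTheory.Transcendental.KZ.of r') = 0 := by
    simp [Literature.NumberTheory.Transcendental.KZ.eval_of, hv]
  have hmem := hO _ (fun z => rfl) _ h0
  refine sup_le le_rfl ((AddSubgroup.closure_le _).mpr ?_) hmem
  rintro d ⟨ρ, hρ, k, z, nn, halg, him, hsum, rfl⟩
  exact hS _ (fun z => rfl) (hZ _ (fun z => rfl)) ρ hρ k z nn halg him hsum

end Summit.KontsevichZagierPeriods.KontsevichZagierPeriods.Theses.HyperbolicBloch
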